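import Summits.Ventures.HSemireg.WedgeBoxHighIndep

/-!
# Venture HSemireg — THEOREM K∘T for the box (7/8)

HONEST FRAMING. Part of the Lean index of the computation cell `pub-hsemireg` (seat p3; Sunday enclosure of the
FORMULA-N kernel assets of seats th-7 / th-6, ENCLOSURE-PLAN-p3.md).  Finite-dimensional exterior algebra over a field ONLY:
no variety, no cohomology theory, no semiregularity map is constructed here; nothing here says that HC / HC_CM / HC_AV holds;
no Literature fact is declared or used.  The geometric DICTIONARY (why these ranks are the `HT`-side box ranks of the cell's
STRUCTURE.md §1 / theory/FORMULA-N.md) lives in theory/FORMULA-N-th7.md PART B §A.3 / §N and is NOT asserted in Lean.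

THEOREM K∘T for the BOX of two point pairs (FORMULA-N PART A §2.3 / PART B §L; th-7 theory/th7/BoxRank.lean v4 sha256/16
88aeb4a1de514ae6, l.1567–1726), file 7 of 8 — generators `I n := Fin (4n)` in four blocks `A 0 = X`, `A 1 = Y` (factor 1), `C 0 = X′`,
`C 1 = Y′` (factor 2); the coefficient-matrix box `boxClass c := Σ_{α,β} c α β • E_{A α ∪ C β}` and the HONEST box `fac1 a * fac2 a′`;
ranks of `θ ↦ θ ∧ box` on `⋀^k` in every degree: `4C(2n,k) − 4C(n,k)` (0 < k < n), the degree-n PURITY DROP `4C(2n,n) − 6` on the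
decomposable locus, `4C(2n,k) − 4C(n,k−n)` (n < k < 2n), `1` in degrees 0 and 2n; one citable form `finrank_range_wedgeMap_fac_mul_all`
(file 8).  No permutation sign is ever evaluated.  th-7's statements and proofs, unchanged (namespace `HSemiregBox` ↦
`Summit.Ventures.HSemireg.WedgeBox`; this family's Fin-indexed `B K n s` is its own, kept apart from `Wedge.B` / `WedgePair.B` by namespace).
Part III/3: the counts `card_filter_A1/C1`, `card_Jk`, **`finrank_range_wedgeMap_fac_mul_high`**: `finrank + 4·C(n,k−n) = 4·C(2n,k)`.
-/

open Module Set Set.powersetCard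

namespace Summit.Ventures.HSemireg.WedgeBox

variable (K : Type*) [Field K] {n : ℕ}

section DegreeHigh

variable {k : ℕ} (c : Fin 2 → Fin 2 → K)

/-! #### Counting `Jk`: `card Jk + 4·C(n, k−n) = 4·C(2n, k)` for `n < k < 2n`. -/

/-- the relevant monomials containing `A 1`, parametrised. -/
lemma filter_A1_eq (hnk : n < k) :
    (Rel n k).filter (fun s => A n 1 ⊆ s) =
      Finset.univ.biUnion fun δ => ((C n δ).powersetCard (k - n)).image fun R => A n 1 ∪ R := by
  ext s
  rw [Finset.mem_filter, Finset.mem_biUnion]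
  constructor
  · rintro ⟨hs, hA⟩
    obtain ⟨δ, hR, hRc, hsR⟩ := exists_of_A1_subset hnk hs hA
    refine ⟨δ, Finset.mem_univ _, Finset.mem_image.mpr ⟨s \ A n 1, ?_, hsR.symm⟩⟩
    exact Finset.mem_powersetCard.mpr ⟨hR, hRc⟩
  · rintro ⟨δ, -, hs⟩
    obtain ⟨R, hR, rfl⟩ := Finset.mem_image.mp hs
    obtain ⟨hRsub, hRc⟩ := Finset.mem_powersetCard.mp hR
    have hRA : ∀ α, Disjoint R (A n α) := fun α =>
      Finset.disjoint_of_subset_left hRsub (disjoint_A_C n α δ).symm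
    have hcard : (A n 1 ∪ R).card = k := by
      rw [Finset.card_union_of_disjoint (hRA 1).symm, card_A, hRc]; omega
    have hdisj : Disjoint (A n 1 ∪ R) (P n 0 (other δ)) := by
      rw [Finset.disjoint_union_left, disjoint_P_iff, disjoint_P_iff]
      exact ⟨⟨disjoint_A_A n (by decide), disjoint_A_C n 1 _⟩, hRA 0,
        Finset.disjoint_of_subset_left hRsub (disjoint_C_C n (other_ne δ).symm)⟩
    exact ⟨mem_Rel_of_disjoint hcard hdisj, Finset.subset_union_left⟩

/-- the relevant monomials containing `C 1`, parametrised by `R ⊆ A γ`, `|R| = k − n`. -/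
lemma filter_C1_eq (hnk : n < k) :
    (Rel n k).filter (fun s => C n 1 ⊆ s) =
      Finset.univ.biUnion fun γ => ((A n γ).powersetCard (k - n)).image fun R => R ∪ C n 1 := by
  ext s
  rw [Finset.mem_filter, Finset.mem_biUnion]
  constructor
  · rintro ⟨hs, hC⟩
    obtain ⟨γ, hR, hRc, hsR⟩ := exists_of_C1_subset hnk hs hC
    refine ⟨γ, Finset.mem_univ _, Finset.mem_image.mpr ⟨s \ C n 1, ?_, hsR.symm⟩⟩
    exact Finset.mem_powersetCard.mpr ⟨hR, hRc⟩
  · rintro ⟨γ, -, hs⟩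
    obtain ⟨R, hR, rfl⟩ := Finset.mem_image.mp hs
    obtain ⟨hRsub, hRc⟩ := Finset.mem_powersetCard.mp hR
    have hRC : ∀ β, Disjoint R (C n β) := fun β =>
      Finset.disjoint_of_subset_left hRsub (disjoint_A_C n γ β)
    have hcard : (R ∪ C n 1).card = k := by
      rw [Finset.card_union_of_disjoint (hRC 1), card_C, hRc]; omega
    have hdisj : Disjoint (R ∪ C n 1) (P n (other γ) 0) := by
      rw [Finset.disjoint_union_left, disjoint_P_iff, disjoint_P_iff]
      exact ⟨⟨Finset.disjoint_of_subset_left hRsub (disjoint_A_A n (other_ne γ).symm), hRC 0⟩,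
        (disjoint_A_C n _ 1).symm, disjoint_C_C n (by decide)⟩
    exact ⟨mem_Rel_of_disjoint hcard hdisj, Finset.subset_union_right⟩

/-- there are `2·C(n, k−n)` relevant monomials containing `A 1`. -/
lemma card_filter_A1 (hnk : n < k) :
    ((Rel n k).filter (fun s => A n 1 ⊆ s)).card = 2 * n.choose (k - n) := by
  rw [filter_A1_eq hnk, Finset.card_biUnion]
  · have : ∀ δ : Fin 2, (((C n δ).powersetCard (k - n)).image fun R => A n 1 ∪ R).card = n.choose (k - n) := by
      intro δ
      rw [Finset.card_image_of_injOn, Finset.card_powersetCard, card_C]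
      intro R hR R' hR' hRR'
      have hd : Disjoint (A n 1) R := (Finset.disjoint_of_subset_left
        (Finset.mem_powersetCard.mp (Finset.mem_coe.mp hR)).1 (disjoint_A_C n 1 δ).symm).symm
      have hd' : Disjoint (A n 1) R' := (Finset.disjoint_of_subset_left
        (Finset.mem_powersetCard.mp (Finset.mem_coe.mp hR')).1 (disjoint_A_C n 1 δ).symm).symm
      have := congr_arg (fun t => t \ A n 1) hRR'
      simp only [Finset.union_sdiff_cancel_left hd, Finset.union_sdiff_cancel_left hd'] at this
      exact this
    simp [this, two_mul]
  · intro δ _ δ' _ hne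
    change Disjoint _ _
    rw [Finset.disjoint_left]
    intro s hs hs'
    obtain ⟨R, hR, rfl⟩ := Finset.mem_image.mp hs
    obtain ⟨R', hR', hRR'⟩ := Finset.mem_image.mp hs'
    obtain ⟨hRsub, hRc⟩ := Finset.mem_powersetCard.mp hR
    obtain ⟨hR'sub, -⟩ := Finset.mem_powersetCard.mp hR'
    have hd : Disjoint (A n 1) R := (Finset.disjoint_of_subset_left hRsub (disjoint_A_C n 1 δ).symm).symm
    have hd' : Disjoint (A n 1) R' := (Finset.disjoint_of_subset_left hR'sub (disjoint_A_C n 1 δ').symm).symm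
    have hRR : R' = R := by
      have := congr_arg (fun t => t \ A n 1) hRR'
      simp only [Finset.union_sdiff_cancel_left hd, Finset.union_sdiff_cancel_left hd'] at this
      exact this
    subst hRR
    obtain ⟨i, hi⟩ : R'.Nonempty := by rw [← Finset.card_pos, hRc]; omega
    exact hne (by
      have h1 := eq_of_mem_C_of_mem_P (hRsub hi) (show i ∈ P n 0 δ' from Finset.mem_union_right _ (hR'sub hi))
      exact h1.symm)

/-- there are `2·C(n, k−n)` relevant monomials containing `C 1`. -/
lemma card_filter_C1 (hnk : n < k) :
    ((Rel n k).filter (fun s => C n 1 ⊆ s)).card = 2 * n.choose (k - n) := by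
  rw [filter_C1_eq hnk, Finset.card_biUnion]
  · have : ∀ γ : Fin 2, (((A n γ).powersetCard (k - n)).image fun R => R ∪ C n 1).card = n.choose (k - n) := by
      intro γ
      rw [Finset.card_image_of_injOn, Finset.card_powersetCard, card_A]
      intro R hR R' hR' hRR'
      have hd : Disjoint R (C n 1) := Finset.disjoint_of_subset_left
        (Finset.mem_powersetCard.mp (Finset.mem_coe.mp hR)).1 (disjoint_A_C n γ 1)
      have hd' : Disjoint R' (C n 1) := Finset.disjoint_of_subset_left
        (Finset.mem_powersetCard.mp (Finset.mem_coe.mp hR')).1 (disjoint_A_C n γ 1)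
      have := congr_arg (fun t => t \ C n 1) hRR'
      simp only [Finset.union_sdiff_cancel_right hd, Finset.union_sdiff_cancel_right hd'] at this
      exact this
    simp [this, two_mul]
  · intro γ _ γ' _ hne
    change Disjoint _ _
    rw [Finset.disjoint_left]
    intro s hs hs'
    obtain ⟨R, hR, rfl⟩ := Finset.mem_image.mp hs
    obtain ⟨R', hR', hRR'⟩ := Finset.mem_image.mp hs'
    obtain ⟨hRsub, hRc⟩ := Finset.mem_powersetCard.mp hR
    obtain ⟨hR'sub, -⟩ := Finset.mem_powersetCard.mp hR'
    have hd : Disjoint R (C n 1) := Finset.disjoint_of_subset_left hRsub (disjoint_A_C n γ 1)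
    have hd' : Disjoint R' (C n 1) := Finset.disjoint_of_subset_left hR'sub (disjoint_A_C n γ' 1)
    have hRR : R' = R := by
      have := congr_arg (fun t => t \ C n 1) hRR'
      simp only [Finset.union_sdiff_cancel_right hd, Finset.union_sdiff_cancel_right hd'] at this
      exact this
    subst hRR
    obtain ⟨i, hi⟩ : R'.Nonempty := by rw [← Finset.card_pos, hRc]; omega
    exact hne (by
      have h1 := eq_of_mem_A_of_mem_P (hRsub hi) (show i ∈ P n γ' 0 from Finset.mem_union_left _ (hR'sub hi))
      exact h1.symm)

/-- `card Jk + 4·C(n, k−n) = card Rel` for `n < k < 2n`. -/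
lemma card_Jk (hnk : n < k) (hk2 : k < n + n) :
    (Jk n k).card + 4 * n.choose (k - n) = (Rel n k).card := by
  have hJ : Jk n k = (Rel n k) \ ((Rel n k).filter (fun s => A n 1 ⊆ s) ∪ (Rel n k).filter (fun s => C n 1 ⊆ s)) := by
    ext s
    rw [mem_Jk, Finset.mem_sdiff, Finset.mem_union, Finset.mem_filter, Finset.mem_filter]
    tauto
  have hsub : (Rel n k).filter (fun s => A n 1 ⊆ s) ∪ (Rel n k).filter (fun s => C n 1 ⊆ s) ⊆ Rel n k :=
    Finset.union_subset (Finset.filter_subset _ _) (Finset.filter_subset _ _)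
  have hdis : Disjoint ((Rel n k).filter (fun s => A n 1 ⊆ s)) ((Rel n k).filter (fun s => C n 1 ⊆ s)) := by
    rw [Finset.disjoint_left]
    intro s hs hs'
    rw [Finset.mem_filter] at hs hs'
    have h1 := Finset.card_le_card (Finset.union_subset hs.2 hs'.2)
    rw [Finset.card_union_of_disjoint (disjoint_A_C n 1 1), card_A, card_C, card_of_mem_Rel hs.1] at h1
    omega
  rw [hJ, Finset.card_sdiff_of_subset hsub, Finset.card_union_of_disjoint hdis, card_filter_A1 hnk,
    card_filter_C1 hnk]
  have := Finset.card_le_card hsub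
  rw [Finset.card_union_of_disjoint hdis, card_filter_A1 hnk, card_filter_C1 hnk] at this
  omega

/-- **THEOREM K∘T for the honest box in the upper degrees `n < k < 2n`**:
`rank(θ ↦ θ ∧ (f₁ ∧ f₂) on ⋀^k) + 4·C(n, k−n) = 4·C(2n, k)`, i.e. `rank = R_k(n) = [t^k](2(1+t)ⁿ − 1 − tⁿ)²`
in that range (`n = 2`, `k = 3`: `16 − 8 = 8` = the STEP-0 `HT³` anchor `56/8/48`). -/
theorem finrank_range_wedgeMap_fac_mul_high (hn : 0 < n) (hnk : n < k) (hk2 : k < n + n)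
    {a a' : Fin 2 → K} (ha : ∀ α, a α ≠ 0) (ha' : ∀ β, a' β ≠ 0) :
    Module.finrank K (LinearMap.range (wedgeMap K n k (fac1 K n a * fac2 K n a'))) + 4 * n.choose (k - n) =
      4 * (n + n).choose k := by
  rw [range_eq_span_vecJk K hn hnk hk2 ha ha',
    finrank_span_eq_card (vecJk_linearIndependent K _ hn hnk (boxCoeff_ne_zero K ha ha')), Fintype.card_coe]
  have h1 := card_Jk (n := n) hnk hk2
  have h2 := card_Rel (n := n) (k := k) (by omega)
  have h3 : n.choose k = 0 := Nat.choose_eq_zero_of_lt hnk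
  omega

end DegreeHigh

/-! ### The two extreme degrees `k = 0`, `k = 2n` (rank `1`) and ONE statement for all `0 ≤ k ≤ 2n`. -/

end Summit.Ventures.HSemireg.WedgeBox
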